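import Summits.NavierStokesRegularity.FunctionalMining.TopEigGapCutoffDeriv
import Summits.NavierStokesRegularity.FunctionalMining.TopEigGapCoerciveSimple
import HarnessLib

/-!
# FunctionalMining — L-λ(η), step (iv)(c): the cut-off estimate at fixed `δ > 0` on the whole
# top-gap class, `Φ₂ − 2δ∫λ₁ ≤ 6 Φ₂^{1/2} ((T₂ + 4δ∫‖S(Δv)‖)/(8π²η))^{1/2}`

Search for candidate a priori estimates; no regularity claim. Cell `pub-nsfunc`, prove seat
(gen 26). Step (iv) of the kernel plan for the dictionary's `@[conjecture]` node `TopEigGapCoerciveTwo η`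
(`TopEigHeatCoerciveGap.lean`; the no-go seat's Proposition L-λ(η), SIEVELD §3.4b (4), pen): the zeros of
the strain. `TopEigGapCoerciveSimple` (gen 25) needs `λ₁` simple EVERYWHERE; on the class this excludes
exactly the fields whose strain vanishes somewhere. Here the assembly is re-run for the cut-off field
`M^δ = G_δ(λ₁)·P₁` (`G_δ = cutRamp δ`, GLOBALLY smooth on the class by `TopEigGapCutoffSmooth`), with the
heat side read through Danskin's formula (`heatDissipation_topEigMoment_eq_integral`, no simplicity
needed) and the cut-off channel density `cutDensity` of `TopEigGapCutoffDeriv`: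

1. HEAT SIDE: `T₂ = −∫2λ₁μ` (`μ = μ(S;S(Δv))`); `∫ cutDensity = −2∫G_δ(λ₁)μ` (`∫∂ₖF^δ_k = 0`), hence
   `∫ cutDensity ≤ T₂ + 4δ∫‖S(Δv)‖` (`0 ≤ λ₁ − G_δ(λ₁) ≤ 2δ`, `|μ| ≤ ‖S(Δv)‖`).
2. GRADIENT SIDE: `∑ₖᵢⱼ(∂ₖM^δᵢⱼ)² ≤ (1/(2η)) cutDensity` pointwise (`TopEigGapCutoffDeriv`).
3. POINCARÉ entrywise (`four_pi_sq_mul_integral_sq_sub_mean_le`).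
4. MOMENT SIDE: `∑ᵢⱼSᵢⱼM^δᵢⱼ = G_δ(λ₁)λ₁`, `∫Sᵢⱼ = 0`, `|S|² ≤ 36λ₁²`, Hölder, and
   `λ₁² − 2δλ₁ ≤ G_δ(λ₁)λ₁`.

CONTENT: `sum_strain_mul_topProj` (`∑ᵢⱼSᵢⱼPᵢⱼ = λ₁` at every point), `sum_strain_mul_cutProj`, and
**`cut_topEigMoment_two_estimate`**. The limit `δ → 0` and the node are in `TopEigGapCoerciveTwo`. [ours]
-/

noncomputable section

open Filter Topology Matrix Finset MeasureTheory
open scoped ContDiff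

namespace Summit.NavierStokesRegularity.FunctionalMining

open Literature.Analysis Literature.Analysis.FunctionSpaces Literature.Analysis.FunctionSpaces.Torus
  SharpClass.DirectorForm Literature.Analysis.Matrix

namespace TopEig

variable {v : UnitAddTorus (Fin 3) → EuclideanSpace ℝ (Fin 3)}

/-! ## 1. Pointwise identities -/

/-- **`∑ᵢⱼ Sᵢⱼ Pᵢⱼ = λ₁`** (`P = u₀ ⊗ u₀`, `S u₀ = λ₁ u₀`, `|u₀| = 1`) — at EVERY point, simple or not.
[ours, bookkeeping] -/
theorem sum_strain_mul_topProj (v : UnitAddTorus (Fin 3) → EuclideanSpace ℝ (Fin 3)) (x : UnitAddTorus (Fin 3)) :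
    ∑ i, ∑ j, torusStrainMatrix v x i j * topProj v x i j = torusStrainTopEig v x := by
  have hmul := mulVec_topVec v x
  have hu := topVec_dotProduct_self v x
  have hq : topVec v x ⬝ᵥ (torusStrainMatrix v x *ᵥ topVec v x) = torusStrainTopEig v x := by
    rw [hmul, dotProduct_smul, hu, smul_eq_mul, mul_one]
  have hexp : topVec v x ⬝ᵥ (torusStrainMatrix v x *ᵥ topVec v x) =
      ∑ i, ∑ j, topVec v x i * (torusStrainMatrix v x i j * topVec v x j) := by
    simp only [dotProduct, Matrix.mulVec, Finset.mul_sum]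
  rw [← hq, hexp]
  refine Finset.sum_congr rfl fun i _ => Finset.sum_congr rfl fun j _ => ?_
  simp only [topProj, Matrix.vecMulVec_apply]
  ring

/-- **`∑ᵢⱼ Sᵢⱼ M^δᵢⱼ = G_δ(λ₁) · λ₁`** at every point. [ours, bookkeeping] -/
theorem sum_strain_mul_cutProj (δ : ℝ) (v : UnitAddTorus (Fin 3) → EuclideanSpace ℝ (Fin 3))
    (x : UnitAddTorus (Fin 3)) :
    ∑ i, ∑ j, torusStrainMatrix v x i j * cutProj δ v i j x =
      cutRamp δ (torusStrainTopEig v x) * torusStrainTopEig v x := by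
  have h := sum_strain_mul_topProj v x
  calc ∑ i, ∑ j, torusStrainMatrix v x i j * cutProj δ v i j x
      = cutRamp δ (torusStrainTopEig v x) * ∑ i, ∑ j, torusStrainMatrix v x i j * topProj v x i j := by
        rw [Finset.mul_sum]
        refine Finset.sum_congr rfl fun i _ => ?_
        rw [Finset.mul_sum]
        refine Finset.sum_congr rfl fun j _ => ?_
        unfold cutProj
        ring
    _ = cutRamp δ (torusStrainTopEig v x) * torusStrainTopEig v x := by rw [h]

/-! ## 2. The estimate at fixed `δ > 0` -/

/-- **THE CUT-OFF ESTIMATE.** For `v` smooth and divergence free on `T³`, `0 < η ≤ 1`,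
`λ₂ ≤ (1−η)λ₁` everywhere, and every `δ > 0`:
`Φ₂(v) − 2δ∫λ₁ ≤ 6 · Φ₂(v)^{1/2} · ( (4π²)⁻¹ (1/(2η)) (T₂(v) + 4δ ∫‖S(Δv)‖) )^{1/2}`.
[ours] -/
theorem cut_topEigMoment_two_estimate (hv : Torus.IsSmooth v) (hdiv : Torus.IsDivFree v)
    {η : ℝ} (hη0 : 0 < η) (hη1 : η ≤ 1)
    (hgap : ∀ x : UnitAddTorus (Fin 3), torusStrainMidEig v x ≤ (1 - η) * torusStrainTopEig v x)
    {δ : ℝ} (hδ : 0 < δ) :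
    torusTopEigMoment 2 v - 2 * δ * ∫ x, torusStrainTopEig v x ≤
      6 * (Real.sqrt (torusTopEigMoment 2 v) *
        Real.sqrt ((4 * Real.pi ^ 2)⁻¹ * (1 / (2 * η) *
          (heatDissipation (torusTopEigMoment 2) v +
            4 * δ * ∫ x, ‖StrainL4.strainFlat (Torus.laplacian v) x‖)))) := by
  have hsimple := simple_of_le_topEig_of_gap hη0 hδ hgap
  -- smoothness of the cut-off fields
  have hMs : ∀ i j, Torus.IsSmooth (cutProj δ v i j) := fun i j =>
    isSmooth_cutRamp_topEig_mul_topProj hv hδ hsimple i j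
  have hFs : ∀ k, Torus.IsSmooth (cutFlux δ v k) := fun k =>
    isSmooth_cutRamp_topEig_mul_partialDeriv_topEig hv hδ hsimple k
  have hl0 : ∀ x, 0 ≤ torusStrainTopEig v x := fun x => by
    rw [← lam_strainFlat]; exact lam_strainFlat_nonneg hv hdiv x
  have hlc : Continuous (torusStrainTopEig v) := continuous_torusStrainTopEig hv
  have hGc : Continuous fun x => cutRamp δ (torusStrainTopEig v x) := (continuous_cutRamp δ).comp hlc
  -- (1) `Φ₂ = ∫ λ₁²`
  have hΦ : torusTopEigMoment 2 v = ∫ x, torusStrainTopEig v x ^ 2 := by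
    rw [torusTopEigMoment_eq hv hdiv 2]
    refine integral_congr_ae (ae_of_all _ fun x => ?_)
    show lam (StrainL4.strainFlat v x) ^ (2 : ℝ) = torusStrainTopEig v x ^ 2
    rw [lam_strainFlat, Real.rpow_two]
  have hF0 : 0 ≤ torusTopEigMoment 2 v := by rw [hΦ]; exact integral_nonneg fun x => sq_nonneg _
  -- (2) HEAT SIDE: Danskin, the density `μ`, and `∫ ρ^δ ≤ T₂ + 4δC`
  set μ : UnitAddTorus (Fin 3) → ℝ := fun x =>
    dirTopEig (StrainL4.strainFlat v x) (StrainL4.strainFlat (Torus.laplacian v) x) with hμdef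
  set C : ℝ := ∫ x, ‖StrainL4.strainFlat (Torus.laplacian v) x‖ with hCdef
  set T : ℝ := heatDissipation (torusTopEigMoment 2) v with hTdef
  have h12 : (1 : ℝ) ≤ 2 := by norm_num
  have hT : T = -∫ x, 2 * torusStrainTopEig v x * μ x := by
    rw [hTdef, heatDissipation_topEigMoment_eq_integral h12 hv hdiv]
    congr 1
    refine integral_congr_ae (ae_of_all _ fun x => ?_)
    dsimp only
    rw [show (2 : ℝ) - 1 = 1 by norm_num, Real.rpow_one]
  have hμm : AEStronglyMeasurable μ volume := by
    have h := aestronglyMeasurable_danskinDensity (q := 1) le_rfl hv hv.laplacian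
    refine h.congr (ae_of_all _ fun x => ?_)
    dsimp only
    rw [show (1 : ℝ) - 1 = 0 by norm_num, Real.rpow_zero]
    ring
  have hμbd : ∀ x, |μ x| ≤ ‖StrainL4.strainFlat (Torus.laplacian v) x‖ := fun x =>
    abs_dirTopEig_le_norm _ _
  have hnc : Continuous fun x => ‖StrainL4.strainFlat (Torus.laplacian v) x‖ :=
    (StrainL4.continuous_strainFlat hv.laplacian).norm
  have hLmu : Integrable (fun x => 2 * torusStrainTopEig v x * μ x) volume := by
    have h := integrable_danskinDensity (q := 2) h12 hv hv.laplacian hdiv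
    refine h.congr (ae_of_all _ fun x => ?_)
    show 2 * torusStrainTopEig v x ^ ((2 : ℝ) - 1) * μ x = 2 * torusStrainTopEig v x * μ x
    rw [show (2 : ℝ) - 1 = 1 by norm_num, Real.rpow_one]
  have hGμ : Integrable (fun x => cutRamp δ (torusStrainTopEig v x) * μ x) volume := by
    refine Integrable.mono' ((hGc.mul hnc).integrable_unitAddTorus) (hGc.aestronglyMeasurable.mul hμm)
      (ae_of_all _ fun x => ?_)
    rw [Real.norm_eq_abs, abs_mul, abs_of_nonneg (cutRamp_nonneg (hl0 x))]
    exact mul_le_mul_of_nonneg_left (hμbd x) (cutRamp_nonneg (hl0 x))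
  have hdivF : ∀ k, Integrable (fun x => Torus.partialDeriv k (cutFlux δ v k) x) volume := fun k =>
    ((hFs k).partialDeriv k).integrable
  have hdivF0 : ∀ k, ∫ x, Torus.partialDeriv k (cutFlux δ v k) x = 0 := fun k =>
    integral_partialDeriv_eq_zero_holds (d := Fin 3) (F := ℝ) (hFs k) k
  have hρint : Integrable (cutDensity δ v) volume := by
    unfold cutDensity
    exact ((integrable_finsetSum _ fun k _ => hdivF k).sub hGμ).const_mul 2
  have hρeq : ∫ x, cutDensity δ v x = -2 * ∫ x, cutRamp δ (torusStrainTopEig v x) * μ x := by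
    unfold cutDensity
    rw [integral_const_mul, integral_sub (integrable_finsetSum _ fun k _ => hdivF k) hGμ,
      integral_finsetSum _ fun k _ => hdivF k]
    simp only [hdivF0, Finset.sum_const_zero, zero_sub]
    ring
  have hρle : ∫ x, cutDensity δ v x ≤ T + 4 * δ * C := by
    -- `∫ρ − T = ∫ 2(λ₁ − G(λ₁)) μ ≤ ∫ 4δ ‖S(Δv)‖`
    have hI : Integrable (fun x => 2 * (torusStrainTopEig v x - cutRamp δ (torusStrainTopEig v x)) * μ x)
        volume := by
      refine (hLmu.sub (hGμ.const_mul 2)).congr (ae_of_all _ fun x => ?_)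
      simp only [Pi.sub_apply]
      ring
    have hbound : ∀ x, 2 * (torusStrainTopEig v x - cutRamp δ (torusStrainTopEig v x)) * μ x ≤
        4 * δ * ‖StrainL4.strainFlat (Torus.laplacian v) x‖ := by
      intro x
      have h1 : 0 ≤ torusStrainTopEig v x - cutRamp δ (torusStrainTopEig v x) :=
        self_sub_cutRamp_nonneg (hl0 x)
      have h2 : torusStrainTopEig v x - cutRamp δ (torusStrainTopEig v x) ≤ 2 * δ :=
        self_sub_cutRamp_le hδ (hl0 x)
      have h3 : μ x ≤ ‖StrainL4.strainFlat (Torus.laplacian v) x‖ := (le_abs_self _).trans (hμbd x)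
      have h4 : 0 ≤ ‖StrainL4.strainFlat (Torus.laplacian v) x‖ := norm_nonneg _
      nlinarith
    have hle := integral_mono hI ((hnc.const_mul (4 * δ)).integrable_unitAddTorus) hbound
    have e1 : ∫ x, 2 * (torusStrainTopEig v x - cutRamp δ (torusStrainTopEig v x)) * μ x =
        (∫ x, 2 * torusStrainTopEig v x * μ x) - 2 * ∫ x, cutRamp δ (torusStrainTopEig v x) * μ x := by
      rw [← integral_const_mul, ← integral_sub hLmu (hGμ.const_mul 2)]
      refine integral_congr_ae (ae_of_all _ fun x => ?_)
      dsimp only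
      ring
    rw [integral_const_mul] at hle
    rw [hρeq, hT]
    linarith
  -- (3) GRADIENT SIDE
  have hGle : ∀ x, ∑ k, ∑ i, ∑ j, (Torus.partialDeriv k (cutProj δ v i j) x) ^ 2 ≤
      1 / (2 * η) * cutDensity δ v x := fun x =>
    sum_sq_partialDeriv_cutProj_le_cutDensity hv hdiv hδ hη0 hη1 hgap x
  have hG0 : ∀ x, 0 ≤ ∑ k, ∑ i, ∑ j, (Torus.partialDeriv k (cutProj δ v i j) x) ^ 2 := fun x =>
    Finset.sum_nonneg fun k _ => Finset.sum_nonneg fun i _ => Finset.sum_nonneg fun j _ => sq_nonneg _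
  have hGint_le : ∫ x, ∑ k, ∑ i, ∑ j, (Torus.partialDeriv k (cutProj δ v i j) x) ^ 2 ≤
      1 / (2 * η) * (T + 4 * δ * C) := by
    have h1 : ∫ x, ∑ k, ∑ i, ∑ j, (Torus.partialDeriv k (cutProj δ v i j) x) ^ 2 ≤
        ∫ x, 1 / (2 * η) * cutDensity δ v x :=
      integral_mono_of_nonneg (ae_of_all _ hG0) (hρint.const_mul _) (ae_of_all _ hGle)
    rw [integral_const_mul] at h1
    have hη' : 0 ≤ 1 / (2 * η) := by positivity
    exact h1.trans (mul_le_mul_of_nonneg_left hρle hη')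
  -- (4) POINCARÉ entrywise and the sum over entries
  have hIk : ∀ i j k, Integrable (fun x => (Torus.partialDeriv k (cutProj δ v i j) x) ^ 2) volume :=
    fun i j k => ((((hMs i j).partialDeriv k).continuous).pow 2).integrable_unitAddTorus
  have hEij : ∀ i j, Integrable (fun x => (cutProj δ v i j x - ∫ y, cutProj δ v i j y) ^ 2) volume :=
    fun i j => (((hMs i j).continuous.sub continuous_const).pow 2).integrable_unitAddTorus
  have hP : ∀ i j, 4 * Real.pi ^ 2 * ∫ x, (cutProj δ v i j x - ∫ y, cutProj δ v i j y) ^ 2 ≤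
      ∫ x, ∑ k, (Torus.partialDeriv k (cutProj δ v i j) x) ^ 2 :=
    fun i j => four_pi_sq_mul_integral_sq_sub_mean_le (hMs i j)
  set D : ℝ := ∑ i, ∑ j, ∫ x, (cutProj δ v i j x - ∫ y, cutProj δ v i j y) ^ 2 with hDdef
  have hD0 : 0 ≤ D := Finset.sum_nonneg fun i _ => Finset.sum_nonneg fun j _ =>
    integral_nonneg fun x => sq_nonneg _
  have hGsum : ∫ x, ∑ k, ∑ i, ∑ j, (Torus.partialDeriv k (cutProj δ v i j) x) ^ 2 =
      ∑ i, ∑ j, ∫ x, ∑ k, (Torus.partialDeriv k (cutProj δ v i j) x) ^ 2 := by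
    have e1 : ∀ x, ∑ k, ∑ i, ∑ j, (Torus.partialDeriv k (cutProj δ v i j) x) ^ 2 =
        ∑ i, ∑ j, ∑ k, (Torus.partialDeriv k (cutProj δ v i j) x) ^ 2 :=
      fun x => sum_three_comm (fun k i j => (Torus.partialDeriv k (cutProj δ v i j) x) ^ 2)
    simp_rw [e1]
    have hIij : ∀ i j, Integrable (fun x => ∑ k, (Torus.partialDeriv k (cutProj δ v i j) x) ^ 2) volume :=
      fun i j => integrable_finsetSum _ fun k _ => hIk i j k
    rw [integral_finsetSum _ fun i _ => integrable_finsetSum _ fun j _ => hIij i j]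
    exact Finset.sum_congr rfl fun i _ => integral_finsetSum _ fun j _ => hIij i j
  have hPD : 4 * Real.pi ^ 2 * D ≤ 1 / (2 * η) * (T + 4 * δ * C) := by
    refine le_trans ?_ hGint_le
    rw [hGsum, hDdef, Finset.mul_sum]
    refine Finset.sum_le_sum fun i _ => ?_
    rw [Finset.mul_sum]
    exact Finset.sum_le_sum fun j _ => hP i j
  -- (5) MOMENT SIDE: `∫ G(λ₁)λ₁ = ∫ S:(M − m) ≤ 6 √Φ₂ √D`
  have hSM : ∀ x, cutRamp δ (torusStrainTopEig v x) * torusStrainTopEig v x =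
      ∑ i, ∑ j, torusStrainMatrix v x i j * (cutProj δ v i j x - ∫ y, cutProj δ v i j y) +
        ∑ i, ∑ j, torusStrainMatrix v x i j * ∫ y, cutProj δ v i j y := by
    intro x
    rw [← sum_strain_mul_cutProj δ v x, ← Finset.sum_add_distrib]
    refine Finset.sum_congr rfl fun i _ => ?_
    rw [← Finset.sum_add_distrib]
    exact Finset.sum_congr rfl fun j _ => by ring
  have hSint : ∀ i j, Integrable (fun x => torusStrainMatrix v x i j) volume :=
    fun i j => (isSmooth_torusStrainMatrix_entry hv i j).integrable
  have hmean0 : ∫ x, ∑ i, ∑ j, torusStrainMatrix v x i j * ∫ y, cutProj δ v i j y = 0 := by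
    rw [integral_finsetSum _ fun i _ => integrable_finsetSum _ fun j _ => (hSint i j).mul_const _]
    refine Finset.sum_eq_zero fun i _ => ?_
    rw [integral_finsetSum _ fun j _ => (hSint i j).mul_const _]
    refine Finset.sum_eq_zero fun j _ => ?_
    rw [integral_mul_const, integral_strainEntry_eq_zero hv i j, zero_mul]
  have hQcont : Continuous fun x => Real.sqrt (∑ i, ∑ j, (cutProj δ v i j x - ∫ y, cutProj δ v i j y) ^ 2) :=
    (continuous_finsetSum _ fun i _ => continuous_finsetSum _ fun j _ =>
      ((hMs i j).continuous.sub continuous_const).pow 2).sqrt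
  have hCS : ∀ x, ∑ i, ∑ j, torusStrainMatrix v x i j * (cutProj δ v i j x - ∫ y, cutProj δ v i j y) ≤
      6 * torusStrainTopEig v x *
        Real.sqrt (∑ i, ∑ j, (cutProj δ v i j x - ∫ y, cutProj δ v i j y) ^ 2) := by
    intro x
    have h1 := Finset.sum_mul_sq_le_sq_mul_sq (Finset.univ : Finset (Fin 3 × Fin 3))
      (fun p => torusStrainMatrix v x p.1 p.2)
      (fun p => cutProj δ v p.1 p.2 x - ∫ y, cutProj δ v p.1 p.2 y)
    simp only [Fintype.sum_prod_type] at h1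
    have h2 := h1.trans (mul_le_mul_of_nonneg_right (sum_sq_strainEntry_le hv hdiv x)
      (Finset.sum_nonneg fun i _ => Finset.sum_nonneg fun j _ => sq_nonneg _))
    have h3 := Real.abs_le_sqrt h2
    rw [Real.sqrt_mul (by positivity), show (36 : ℝ) * torusStrainTopEig v x ^ 2 =
      (6 * torusStrainTopEig v x) ^ 2 by ring, Real.sqrt_sq (by linarith [hl0 x])] at h3
    exact (le_abs_self _).trans h3
  have hI1 : Integrable (fun x => ∑ i, ∑ j, torusStrainMatrix v x i j *
      (cutProj δ v i j x - ∫ y, cutProj δ v i j y)) volume :=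
    (continuous_finsetSum _ fun i _ => continuous_finsetSum _ fun j _ =>
      (isSmooth_torusStrainMatrix_entry hv i j).continuous.mul
        ((hMs i j).continuous.sub continuous_const)).integrable_unitAddTorus
  have hI2 : Integrable (fun x => ∑ i, ∑ j, torusStrainMatrix v x i j * ∫ y, cutProj δ v i j y) volume :=
    (continuous_finsetSum _ fun i _ => continuous_finsetSum _ fun j _ =>
      (isSmooth_torusStrainMatrix_entry hv i j).continuous.mul continuous_const).integrable_unitAddTorus
  have hstep : ∫ x, cutRamp δ (torusStrainTopEig v x) * torusStrainTopEig v x =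
      ∫ x, ∑ i, ∑ j, torusStrainMatrix v x i j * (cutProj δ v i j x - ∫ y, cutProj δ v i j y) := by
    rw [integral_congr_ae (ae_of_all _ hSM), integral_add hI1 hI2, hmean0, add_zero]
  have hD' : ∫ x, ∑ i, ∑ j, (cutProj δ v i j x - ∫ y, cutProj δ v i j y) ^ 2 = D := by
    rw [hDdef, integral_finsetSum _ fun i _ => integrable_finsetSum _ fun j _ => hEij i j]
    exact Finset.sum_congr rfl fun i _ => integral_finsetSum _ fun j _ => hEij i j
  have hFle : ∫ x, cutRamp δ (torusStrainTopEig v x) * torusStrainTopEig v x ≤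
      6 * (Real.sqrt (torusTopEigMoment 2 v) * Real.sqrt D) := by
    have hf : MemLp (fun x => torusStrainTopEig v x) (ENNReal.ofReal 2) volume :=
      hlc.memLp_of_hasCompactSupport (HasCompactSupport.of_compactSpace _)
    have hg : MemLp (fun x => Real.sqrt (∑ i, ∑ j, (cutProj δ v i j x - ∫ y, cutProj δ v i j y) ^ 2))
        (ENNReal.ofReal 2) volume :=
      hQcont.memLp_of_hasCompactSupport (HasCompactSupport.of_compactSpace _)
    have hH := integral_mul_le_Lp_mul_Lq_of_nonneg (μ := volume) Real.HolderConjugate.two_two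
      (ae_of_all _ fun x => hl0 x) (ae_of_all _ fun x => Real.sqrt_nonneg _) hf hg
    have e1 : ∫ x, torusStrainTopEig v x ^ (2 : ℝ) = torusTopEigMoment 2 v := by
      rw [hΦ]; exact integral_congr_ae (ae_of_all _ fun x => Real.rpow_two _)
    have e2 : ∫ x, Real.sqrt (∑ i, ∑ j, (cutProj δ v i j x - ∫ y, cutProj δ v i j y) ^ 2) ^ (2 : ℝ) = D := by
      rw [← hD']
      refine integral_congr_ae (ae_of_all _ fun x => ?_)
      dsimp only
      rw [Real.rpow_two, Real.sq_sqrt (Finset.sum_nonneg fun i _ => Finset.sum_nonneg fun j _ => sq_nonneg _)]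
    rw [e1, e2, ← Real.sqrt_eq_rpow, ← Real.sqrt_eq_rpow] at hH
    calc ∫ x, cutRamp δ (torusStrainTopEig v x) * torusStrainTopEig v x = _ := hstep
      _ ≤ ∫ x, 6 * torusStrainTopEig v x *
            Real.sqrt (∑ i, ∑ j, (cutProj δ v i j x - ∫ y, cutProj δ v i j y) ^ 2) :=
          integral_mono hI1 ((continuous_const.mul hlc).mul hQcont).integrable_unitAddTorus hCS
      _ = 6 * ∫ x, torusStrainTopEig v x *
            Real.sqrt (∑ i, ∑ j, (cutProj δ v i j x - ∫ y, cutProj δ v i j y) ^ 2) := by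
          rw [← integral_const_mul]
          exact integral_congr_ae (ae_of_all _ fun x => by ring)
      _ ≤ 6 * (Real.sqrt (torusTopEigMoment 2 v) * Real.sqrt D) := by linarith
  -- (6) LOWER BOUND `Φ₂ − 2δ ∫λ₁ ≤ ∫ G(λ₁) λ₁`
  have hlow : torusTopEigMoment 2 v - 2 * δ * ∫ x, torusStrainTopEig v x ≤
      ∫ x, cutRamp δ (torusStrainTopEig v x) * torusStrainTopEig v x := by
    have hI3 : Integrable (fun x => torusStrainTopEig v x ^ 2 - 2 * δ * torusStrainTopEig v x) volume :=
      ((hlc.pow 2).sub (continuous_const.mul hlc)).integrable_unitAddTorus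
    have hI4 : Integrable (fun x => cutRamp δ (torusStrainTopEig v x) * torusStrainTopEig v x) volume :=
      (hGc.mul hlc).integrable_unitAddTorus
    have hpt : ∀ x, torusStrainTopEig v x ^ 2 - 2 * δ * torusStrainTopEig v x ≤
        cutRamp δ (torusStrainTopEig v x) * torusStrainTopEig v x := by
      intro x
      have h1 := self_sub_le_cutRamp hδ (hl0 x)
      have h2 := hl0 x
      nlinarith
    have hle := integral_mono hI3 hI4 hpt
    have hI5 : Integrable (fun x => torusStrainTopEig v x ^ 2) volume := (hlc.pow 2).integrable_unitAddTorus
    have hI6 : Integrable (fun x => 2 * δ * torusStrainTopEig v x) volume :=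
      (continuous_const.mul hlc).integrable_unitAddTorus
    have e1 : ∫ x, (torusStrainTopEig v x ^ 2 - 2 * δ * torusStrainTopEig v x) =
        torusTopEigMoment 2 v - 2 * δ * ∫ x, torusStrainTopEig v x := by
      rw [integral_sub hI5 hI6, integral_const_mul, hΦ]
    rw [e1] at hle
    exact hle
  -- (7) assembly
  have hπ : 0 < 4 * Real.pi ^ 2 := by positivity
  have hDle : D ≤ (4 * Real.pi ^ 2)⁻¹ * (1 / (2 * η) * (T + 4 * δ * C)) := by
    rw [le_inv_mul_iff₀ hπ]
    exact hPD
  have hsqrt : Real.sqrt D ≤ Real.sqrt ((4 * Real.pi ^ 2)⁻¹ * (1 / (2 * η) * (T + 4 * δ * C))) :=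
    Real.sqrt_le_sqrt hDle
  have hsF0 : 0 ≤ Real.sqrt (torusTopEigMoment 2 v) := Real.sqrt_nonneg _
  calc torusTopEigMoment 2 v - 2 * δ * ∫ x, torusStrainTopEig v x
      ≤ ∫ x, cutRamp δ (torusStrainTopEig v x) * torusStrainTopEig v x := hlow
    _ ≤ 6 * (Real.sqrt (torusTopEigMoment 2 v) * Real.sqrt D) := hFle
    _ ≤ 6 * (Real.sqrt (torusTopEigMoment 2 v) *
        Real.sqrt ((4 * Real.pi ^ 2)⁻¹ * (1 / (2 * η) * (T + 4 * δ * C)))) :=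
        mul_le_mul_of_nonneg_left (mul_le_mul_of_nonneg_left hsqrt hsF0) (by norm_num)

end TopEig

end Summit.NavierStokesRegularity.FunctionalMining

end
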